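import Literature.NumberTheory.LFunctions.WeilOddGroundState
import Literature.NumberTheory.LFunctions.WeilWindowSimpleEven
import Literature.NumberTheory.LFunctions.YoshidaOddCriterion
import HarnessLib

/-!
# The parity split `ε(a) = min (ε_ev(a), ε_od(a))` of the Weil ground energy

Sibling of `Literature/NumberTheory/LFunctions/WeilExplicit.lean` and
`Literature/NumberTheory/LFunctions/WeilOddGroundState.lean` (same normalisation: additive variable
`t = log x`, `ĝ(s) = weilMellin g s = ∫ g(t) e^{(s - 1/2)t} dt`, `g̃(t) = conj g(-t)`,
`Q(g) = weilQuadratic g = W(g ⋆ g̃)`, test functions `IsWeilTest g` (smooth, compact support),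
window `tsupport g ⊆ [-a, a]`, ground energy
`ε(a) = weilGroundEnergy a = inf {Re Q(g) : tsupport g ⊆ [-a, a], ∫ |g|² = 1}`, odd-sector ground
energy `ε_od(a) = weilOddGroundEnergy a`, the same infimum over ODD `g`, `g(-t) = -g(t)`).

## The sources

Bombieri (*Remarks on Weil's quadratic functional I*, Rend. Lincei (9) 11 (2000); §2, p. 186:
for `f` on `(0, ∞)`, `f*(x) := x⁻¹ f(1/x)`, "`f` is even if `f = f*` and odd if `f = -f*`"; §4,
Theorem 5, p. 197):

> Let `μ⁺(M)` and `μ⁻(M)` be the infimum of `T[f * f̄*]` in the class of even and odd functions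
> in `L²([M⁻¹, M])` of norm `1`. Then `μ⁺(M)` and `μ⁻(M)` are continuous decreasing functions of
> `M`. (Proof: "It is clear that the functions `μ^±(M)` are decreasing functions of `M` …")

Under the dictionary `f(x) = x^{-1/2} g(log x)`, `M = e^a` of `WeilExplicit.lean` one has
`f*(x) = x^{-1/2} g(-log x)`, so `f = ∓f*` iff `g(-t) = ∓g(t)`, `‖f‖²_{L²(dx)} = ∫ |g|² dt`,
`[M⁻¹, M] ↔ [-a, a]`, `T[f * f̄*] = Q(g)`; `weilOddGroundEnergy a` (`WeilOddGroundState.lean`) is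
`μ⁻(e^a)` and `weilEvenGroundEnergy a` below is `μ⁺(e^a)`, both taken over SMOOTH tests as
`weilGroundEnergy` is (Bombieri minimises over `L²`-functions of the window; not compared here).

M. Suzuki (*Weil's quadratic form via the screw function*, arXiv:2606.09096 (2026), §4.5, arXiv p. 18)
defines `λ_a^± := inf` of the Rayleigh quotient over even / odd functions and proves

> (4.10) `λ_a = min(λ_a⁺, λ_a⁻)`. … Every `v` admits a unique decomposition into even and odd
> components `v = v⁺ + v⁻` … the cross terms vanish … `‖v‖² = ‖v⁺‖² + ‖v⁻‖²` … for each
> component `⟨…⟩ ≥ λ_a^∙ ‖v^∙‖²` … which yields `λ_a ≥ min(λ_a⁺, λ_a⁻)`. Conversely, restricting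
> the Rayleigh quotient … immediately yields `λ_a ≤ min(λ_a⁺, λ_a⁻)`.

This file proves exactly this for the tree's `ε`, `ε_ev`, `ε_od` (`weilGroundEnergy_eq_min_even_odd`),
the vanishing of the cross terms being the tree's `weilQuadratic_eq_evenPart_add_oddPart`
(`WeilWindowSimpleEven.lean`; Connes–Consani 2023 §2.1.3, `QW_λ = QW_λ⁺ ⊕ QW_λ⁻`).

## Contents (everything is proved; no named facts are introduced)

* `weilEvenGroundEnergy a = ε_ev(a)` — the even twin of `weilOddGroundEnergy` (DEFINITION, real
  `sInf`, junk value `0` for `a ≤ 0`).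
* `weilWindowSphereValues P a` — the value set `{Re Q(g) : g test on the window, P g, ∫|g|² = 1}`
  for a constraint `P`; `ε_od`, `ε_ev` are its `sInf` by `rfl`, `ε` for `P = ⊤`
  (`weilGroundEnergy_eq_sInf`). Generic bookkeeping: bounded below, monotone in the window,
  empty for `a ≤ 0`, `csInf` wrappers, and the homogeneous bound `sInf · ∫|g|² ≤ Re Q(g)` for
  scaling-stable `P` (`weilQuadratic_const_mul`), whence `0 ≤ sInf ↔ (Re Q ≥ 0 on P-tests)`.
* `exists_isWeilTest_sphere_of_sign`, `exists_isWeilTest_even_sphere` — for `a > 0` the even unit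
  sphere of the window is nonempty (an off-centre bump `β(t) + β(-t)`, normalised; the odd one is
  `exists_isWeilTest_odd_sphere` of `WeilOddGroundState.lean`).
* Monotonicity (Bombieri Thm 5, "decreasing"): `weilEvenGroundEnergy_antitone`, the `AntitoneOn`
  forms `weilOddGroundEnergy_antitoneOn`, `weilEvenGroundEnergy_antitoneOn`, and the parity-free
  `weilGroundEnergy_anti` / `weilGroundEnergy_antitoneOn`.
* Homogeneous bounds `weilOddGroundEnergy_mul_le_re`, `weilEvenGroundEnergy_mul_le_re`, lower-bound
  constructors `le_weilOddGroundEnergy_of_forall`, `le_weilEvenGroundEnergy_of_forall`.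
* `weilGroundEnergy_eq_min_even_odd` — **`ε(a) = min (ε_ev(a), ε_od(a))`** for every `a`, with
  `integral_norm_sq_evenPart_add_oddPart` (`‖g‖² = ‖g_ev‖² + ‖g_od‖²`).
* `weilOddGroundEnergy_nonneg_iff` (`0 ≤ ε_od(a)` iff `Re Q ≥ 0` on odd window tests), the even
  twin, `weilOddGroundEnergy_nonneg_of_riemannHypothesis` (RH ⇒ `ε_od ≥ 0`, via the PROVED half
  `yoshida_odd_criterion_mp`), and — GIVEN the named fact `yoshida_odd_criterion` (Yoshida 1992,
  Prop. 1(1), `YoshidaOddCriterion.lean`) — `RH ↔ ∀ a > 0, 0 ≤ ε_od(a)`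
  (`yoshida_odd_criterion.riemannHypothesis_iff_weilOddGroundEnergy_nonneg`).

Not here: continuity of `ε_od`, `ε_ev` in `a` (the other half of Bombieri's Thm 5; Suzuki §4.5
remarks that "the details of the proof are not fully provided" in [Bo01]); existence of even / odd
minimisers; any claim that `ε_od(a) ≥ 0` at some window (RH-strength; route `OddSector`).

## References

* E. Bombieri, *Remarks on Weil's quadratic functional in the theory of prime numbers I*, Rend.
  Mat. Acc. Lincei (9) 11 (2000), 183–233: §2 p. 186 (parity `f = ±f*`), §4 Problem 2 (p. 193),
  Theorem 5 (p. 197).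
* M. Suzuki, *Weil's quadratic form via the screw function*, arXiv:2606.09096 (2026), §4.5,
  eq. (4.10) and its proof (arXiv p. 18).
* A. Connes, C. Consani, *Spectral triples and ζ-cycles*, Enseign. Math. 69 (2023), §2.1.3.
* H. Yoshida, *On Hermitian forms attached to zeta functions*, Adv. Stud. Pure Math. 21 (1992),
  Prop. 1(1) (oddly positive definite ⇔ RH).
-/

noncomputable section

open Complex Filter Set MeasureTheory
open scoped Real Topology ComplexConjugate

namespace Literature.NumberTheory.LFunctions

/-! ## The even twin and the value sets -/

/-- **The even-sector ground energy** of the truncated Weil form,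
`ε_ev(a) := inf {Re Q(g) : g smooth of compact support, tsupport g ⊆ [-a, a], g even, ∫ |g|² = 1}`,
`Q(g) = W(g ⋆ g̃) = weilQuadratic g`: the tree's rendering (infimum over smooth tests, exactly as
`weilGroundEnergy` and `weilOddGroundEnergy`) of Bombieri's `μ⁺(M)`, "the infimum of `T[f * f̄*]` in
the class of even functions in `L²([M⁻¹, M])` of norm 1" (`f` even iff `f = f*`, `f*(x) = x⁻¹f(1/x)`,
i.e. `g(-t) = g(t)` for `f(x) = x^{-1/2} g(log x)`, `M = e^a`), and of Suzuki's `λ_a⁺`.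
DEFINITION ONLY: a real `sInf`, with junk value `0` for `a ≤ 0` (empty sphere,
`weilEvenGroundEnergy_of_nonpos`); the set is bounded below (`bddBelow_weilWindowSphereValues`)
and nonempty for `a > 0` (`exists_isWeilTest_even_sphere`). Evenness is spelled `∀ t, g (-t) = g t`
as in `WeilWindowSimpleEven`. [cite: Bombieri2000Weil, §4 Thm. 5 (p. 197), μ⁺(M); parity §2 p. 186] -/
def weilEvenGroundEnergy (a : ℝ) : ℝ :=
  sInf {x : ℝ | ∃ g : ℝ → ℂ, IsWeilTest g ∧ tsupport g ⊆ Icc (-a) a ∧ (∀ t, g (-t) = g t) ∧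
    ∫ t : ℝ, ‖g t‖ ^ 2 = 1 ∧ x = (weilQuadratic g).re}

/-- The set of values `Re Q(g)` over the `L²`-unit sphere of test functions on the window `[-a, a]`
subject to an extra constraint `P` (a parity, an orthogonality condition, or nothing): the set whose
infimum is the `P`-restricted ground energy (Bombieri 2000 §4, Problem 2: minimise `T[f * f̄*]` on
the unit sphere of `L²(E)`; restricted classes in Thm. 5). `weilOddGroundEnergy a` and
`weilEvenGroundEnergy a` are `sInf` of it by `rfl`, `weilGroundEnergy a` for `P = ⊤`
(`weilGroundEnergy_eq_sInf`). [folklore] -/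
def weilWindowSphereValues (P : (ℝ → ℂ) → Prop) (a : ℝ) : Set ℝ :=
  {x : ℝ | ∃ g : ℝ → ℂ, IsWeilTest g ∧ tsupport g ⊆ Icc (-a) a ∧ P g ∧
    ∫ t : ℝ, ‖g t‖ ^ 2 = 1 ∧ x = (weilQuadratic g).re}

/-- Unfolding: `ε_od(a) = sInf` of the odd-constrained value set. [folklore] -/
theorem weilOddGroundEnergy_eq_sInf (a : ℝ) :
    weilOddGroundEnergy a = sInf (weilWindowSphereValues (fun g ↦ ∀ t, g (-t) = -g t) a) :=
  rfl

/-- Unfolding: `ε_ev(a) = sInf` of the even-constrained value set. [folklore] -/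
theorem weilEvenGroundEnergy_eq_sInf (a : ℝ) :
    weilEvenGroundEnergy a = sInf (weilWindowSphereValues (fun g ↦ ∀ t, g (-t) = g t) a) :=
  rfl

/-- Unfolding: `ε(a) = sInf` of the unconstrained value set (`P = ⊤`). [folklore] -/
theorem weilGroundEnergy_eq_sInf (a : ℝ) :
    weilGroundEnergy a = sInf (weilWindowSphereValues (fun _ ↦ True) a) := by
  rw [weilGroundEnergy]
  congr 1
  ext x
  simp only [weilWindowSphereValues, true_and, mem_setOf_eq]

/-! ## Generic bookkeeping for the restricted value sets -/

section Generic

variable {P : (ℝ → ℂ) → Prop} {a b x : ℝ} {g : ℝ → ℂ}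

/-- A restricted value set is contained in the unrestricted one. [folklore] -/
theorem weilWindowSphereValues_subset_top (P : (ℝ → ℂ) → Prop) (a : ℝ) :
    weilWindowSphereValues P a ⊆ weilWindowSphereValues (fun _ ↦ True) a := by
  rintro x ⟨g, hg, hs, -, hn, hx⟩
  exact ⟨g, hg, hs, trivial, hn, hx⟩

/-- Every restricted value set is bounded below (it is a subset of the full one, which is bounded
below by Bombieri 2000 §4 Lemma 3 / Thm 3, `bddBelow_weilQuadratic_sphere_holds`). [folklore] -/
theorem bddBelow_weilWindowSphereValues (P : (ℝ → ℂ) → Prop) (a : ℝ) :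
    BddBelow (weilWindowSphereValues P a) := by
  refine (bddBelow_weilQuadratic_sphere_holds a).mono ?_
  rintro x ⟨g, hg, hs, -, hn, hx⟩
  exact ⟨g, hg, hs, hn, hx⟩

/-- The value sets increase with the window: `b ≤ a → S_P(b) ⊆ S_P(a)`. [folklore] -/
theorem weilWindowSphereValues_mono (P : (ℝ → ℂ) → Prop) (hba : b ≤ a) :
    weilWindowSphereValues P b ⊆ weilWindowSphereValues P a := by
  rintro x ⟨g, hg, hs, hP, hn, hx⟩
  exact ⟨g, hg, hs.trans (Icc_subset_Icc (neg_le_neg hba) hba), hP, hn, hx⟩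

/-- The junk regime: for `a ≤ 0` the window `[-a, a]` is Lebesgue-null, a test function supported
in it has `∫ |g|² = 0 ≠ 1`, and every value set is empty. [folklore] -/
theorem weilWindowSphereValues_eq_empty (P : (ℝ → ℂ) → Prop) (ha : a ≤ 0) :
    weilWindowSphereValues P a = ∅ := by
  ext x
  simp only [mem_empty_iff_false, iff_false]
  rintro ⟨g, -, hsupp, -, hnorm, -⟩
  have hvol : volume (Icc (-a) a) = 0 := by
    rw [Real.volume_Icc, ENNReal.ofReal_eq_zero]
    linarith
  have hae : (fun t : ℝ ↦ ‖g t‖ ^ 2) =ᵐ[volume] fun _ ↦ (0 : ℝ) := by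
    filter_upwards [measure_eq_zero_iff_ae_notMem.1 hvol] with t ht
    rw [image_eq_zero_of_notMem_tsupport fun h ↦ ht (hsupp h), norm_zero, zero_pow two_ne_zero]
  rw [integral_congr_ae hae, integral_zero] at hnorm
  exact zero_ne_one hnorm

/-- Hence every restricted ground energy is the junk value `sInf ∅ = 0` for `a ≤ 0`. [folklore] -/
theorem sInf_weilWindowSphereValues_of_nonpos (P : (ℝ → ℂ) → Prop) (ha : a ≤ 0) :
    sInf (weilWindowSphereValues P a) = 0 := by
  rw [weilWindowSphereValues_eq_empty P ha, Real.sInf_empty]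

/-- Monotonicity of restricted ground energies: if the smaller window's sphere is nonempty then
`sInf S_P(a) ≤ sInf S_P(b)` for `b ≤ a` (Bombieri 2000 Thm 5: "decreasing functions of `M`").
[cite: Bombieri2000Weil, §4 Thm. 5 (proof, first sentence)] -/
theorem sInf_weilWindowSphereValues_anti (P : (ℝ → ℂ) → Prop)
    (hne : (weilWindowSphereValues P b).Nonempty) (hba : b ≤ a) :
    sInf (weilWindowSphereValues P a) ≤ sInf (weilWindowSphereValues P b) :=
  csInf_le_csInf (bddBelow_weilWindowSphereValues P a) hne (weilWindowSphereValues_mono P hba)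

/-- Elements of the restricted sphere bound the restricted energy from above. [folklore] -/
theorem sInf_weilWindowSphereValues_le_re (hg : IsWeilTest g) (hs : tsupport g ⊆ Icc (-a) a)
    (hP : P g) (hn : ∫ t : ℝ, ‖g t‖ ^ 2 = 1) :
    sInf (weilWindowSphereValues P a) ≤ (weilQuadratic g).re :=
  csInf_le (bddBelow_weilWindowSphereValues P a) ⟨g, hg, hs, hP, hn, rfl⟩

/-- A lower bound valid on a nonempty restricted sphere bounds the restricted energy from below.
[folklore] -/
theorem le_sInf_weilWindowSphereValues (hne : (weilWindowSphereValues P a).Nonempty)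
    (hb : ∀ g : ℝ → ℂ, IsWeilTest g → tsupport g ⊆ Icc (-a) a → P g →
      ∫ t : ℝ, ‖g t‖ ^ 2 = 1 → x ≤ (weilQuadratic g).re) :
    x ≤ sInf (weilWindowSphereValues P a) := by
  refine le_csInf hne ?_
  rintro y ⟨g, hg, hs, hP, hn, rfl⟩
  exact hb g hg hs hP hn

/-- **The homogeneous lower bound**: if the constraint `P` holds for all positive real multiples of
a test function `g` supported in the window, then `sInf S_P(a) · ∫ |g|² ≤ Re Q(g)` (normalise `g`,
`Q(c g) = |c|² Q(g)` by `weilQuadratic_const_mul`; for `∫ |g|² = 0`, `g = 0` and `Q(0) = 0`).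
(Bombieri 2000 §4 Problem 2: `λ = T[f * f̄*] / ‖f‖²`.)
[cite: Bombieri2000Weil, §4 Problem 2 (p. 193)] -/
theorem sInf_weilWindowSphereValues_mul_le_re (hg : IsWeilTest g)
    (hsupp : tsupport g ⊆ Icc (-a) a) (hP : ∀ c : ℝ, 0 < c → P fun t ↦ (c : ℂ) * g t) :
    sInf (weilWindowSphereValues P a) * ∫ t, ‖g t‖ ^ 2 ≤ (weilQuadratic g).re := by
  have hN2nn : 0 ≤ ∫ t : ℝ, ‖g t‖ ^ 2 := integral_nonneg fun _ ↦ by positivity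
  rcases hN2nn.eq_or_lt with hz | hpos
  · have hg0 : g = 0 := hg.eq_zero_of_integral_norm_sq_eq_zero hz.symm
    subst hg0
    rw [weilQuadratic_zero, Complex.zero_re, ← hz, mul_zero]
  · set N2 : ℝ := ∫ t : ℝ, ‖g t‖ ^ 2 with hN2
    set c : ℝ := (Real.sqrt N2)⁻¹ with hc
    have hcpos : 0 < c := inv_pos.2 (Real.sqrt_pos.2 hpos)
    have hmem : (weilQuadratic fun t ↦ (c : ℂ) * g t).re ∈ weilWindowSphereValues P a := by
      refine ⟨fun t ↦ (c : ℂ) * g t, hg.const_mul c, tsupport_mul_subset_right.trans hsupp,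
        hP c hcpos, ?_, rfl⟩
      simp only [norm_mul, mul_pow, Complex.norm_real, Real.norm_of_nonneg hcpos.le]
      rw [integral_const_mul, hc, inv_pow, Real.sq_sqrt hN2nn, inv_mul_cancel₀ hpos.ne']
    have hle : sInf (weilWindowSphereValues P a) ≤ (weilQuadratic fun t ↦ (c : ℂ) * g t).re :=
      csInf_le (bddBelow_weilWindowSphereValues P a) hmem
    have hQ' : (weilQuadratic fun t ↦ (c : ℂ) * g t).re = c * c * (weilQuadratic g).re := by
      rw [weilQuadratic_const_mul, Complex.normSq_ofReal, Complex.re_ofReal_mul]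
    have hcc : c * c * N2 = 1 := by
      rw [hc, ← mul_inv, Real.mul_self_sqrt hN2nn, inv_mul_cancel₀ hpos.ne']
    have h1 : sInf (weilWindowSphereValues P a) * (c * c * N2) ≤
        c * c * (weilQuadratic g).re := by
      rw [hcc, mul_one, ← hQ']
      exact hle
    have h2 : c * c * (sInf (weilWindowSphereValues P a) * N2) ≤
        c * c * (weilQuadratic g).re := by
      linarith
    exact le_of_mul_le_mul_left h2 (mul_pos hcpos hcpos)

/-- A restricted energy is `≥ 0` iff `Re Q ≥ 0` on all window tests with the (scaling-stable)
constraint: `←` by `Real.sInf_nonneg` (covering the empty sphere), `→` by the homogeneous bound.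
[folklore] -/
theorem sInf_weilWindowSphereValues_nonneg_iff
    (hP : ∀ (c : ℝ) (g : ℝ → ℂ), 0 < c → P g → P fun t ↦ (c : ℂ) * g t) :
    0 ≤ sInf (weilWindowSphereValues P a) ↔
      ∀ g : ℝ → ℂ, IsWeilTest g → tsupport g ⊆ Icc (-a) a → P g →
        0 ≤ (weilQuadratic g).re := by
  constructor
  · intro h g hg hs hPg
    have hN : 0 ≤ ∫ t : ℝ, ‖g t‖ ^ 2 := integral_nonneg fun _ ↦ by positivity
    exact (mul_nonneg h hN).trans
      (sInf_weilWindowSphereValues_mul_le_re hg hs fun c hc ↦ hP c g hc hPg)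
  · intro h
    refine Real.sInf_nonneg ?_
    rintro x ⟨g, hg, hs, hPg, -, rfl⟩
    exact h g hg hs hPg

end Generic

/-! ## Symmetric windows: supports of reflections and symmetrisations -/

/-- On the symmetric window `[-a, a]`: if `tsupport g ⊆ [-a, a]` then every function vanishing
wherever `g` and `g(-·)` both vanish (a reflection, an even or odd part, `g ± g(-·)`) is again
supported in `[-a, a]` (outside the closed window both `g` and `g(-·)` vanish on an open set).
[folklore] -/
theorem tsupport_subset_Icc_of_symm {g h : ℝ → ℂ} {a : ℝ} (hg : tsupport g ⊆ Icc (-a) a)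
    (hh : ∀ s, g s = 0 → g (-s) = 0 → h s = 0) : tsupport h ⊆ Icc (-a) a := by
  intro t ht
  by_contra hta
  have hopen : IsOpen (Icc (-a) a)ᶜ := isClosed_Icc.isOpen_compl
  have hzero : ∀ s ∈ (Icc (-a) a)ᶜ, h s = 0 := by
    intro s hs
    have hs' : -s ∉ Icc (-a) a := fun hns ↦ hs (by
      rw [mem_Icc] at hns ⊢
      constructor <;> linarith [hns.1, hns.2])
    exact hh s (image_eq_zero_of_notMem_tsupport fun h' ↦ hs (hg h'))
      (image_eq_zero_of_notMem_tsupport fun h' ↦ hs' (hg h'))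
  have hev : h =ᶠ[𝓝 t] 0 := by
    filter_upwards [hopen.mem_nhds hta] with s hs
    exact hzero s hs
  exact (notMem_tsupport_iff_eventuallyEq.2 hev) ht

/-! ## The even unit sphere of a window is nonempty -/

/-- For `a > 0` and a sign `σ` with `σ² = 1` there is a test function `g` on the window `[-a, a]`
with `g(-t) = σ g(t)` and `∫ |g|² = 1`: Mathlib's smooth bump `β` of radii `a/4 < a/2` centred at
`a/2` (`tsupport β = [0, a]`, `β(a/2) = 1`, `β(-a/2) = 0`), symmetrised to `β(t) + σ β(-t)`
(value `1` at `a/2`, hence nonzero in `L²`) and normalised. (For `σ = -1` compare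
`exists_isWeilTest_odd_sphere` of `WeilOddGroundState.lean`.) [folklore] -/
theorem exists_isWeilTest_sphere_of_sign {a : ℝ} (ha : 0 < a) {σ : ℂ} (hσ : σ * σ = 1) :
    ∃ g : ℝ → ℂ, IsWeilTest g ∧ tsupport g ⊆ Icc (-a) a ∧ (∀ t, g (-t) = σ * g t) ∧
      ∫ t, ‖g t‖ ^ 2 = (1 : ℝ) := by
  set β : ContDiffBump (a / 2 : ℝ) := ⟨a / 4, a / 2, by positivity, by linarith⟩ with hβ
  have hrOut : β.rOut = a / 2 := by rw [hβ]
  have hβ1 : β (a / 2) = 1 :=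
    β.one_of_mem_closedBall (Metric.mem_closedBall_self β.rIn_pos.le)
  have hβ0 : β (-(a / 2)) = 0 := by
    refine β.zero_of_le_dist ?_
    rw [hrOut, Real.dist_eq, show -(a / 2) - a / 2 = -a by ring, abs_neg, abs_of_pos ha]
    linarith
  set g₀ : ℝ → ℂ := fun t ↦ ((β t : ℝ) : ℂ) with hg₀
  have hg₀t : IsWeilTest g₀ :=
    ⟨Complex.ofRealCLM.contDiff.comp β.contDiff,
      β.hasCompactSupport.comp_left Complex.ofReal_zero⟩
  have hsupp₀ : tsupport g₀ ⊆ Icc (-a) a := by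
    refine (tsupport_comp_subset Complex.ofReal_zero _).trans ?_
    rw [β.tsupport_eq, Real.closedBall_eq_Icc, hrOut]
    exact Icc_subset_Icc (by linarith) (by linarith)
  set g₁ : ℝ → ℂ := fun t ↦ g₀ t + σ * g₀ (-t) with hg₁
  have hg₁t : IsWeilTest g₁ := hg₀t.add (hg₀t.comp_neg.const_mul σ)
  have hpar₁ : ∀ t, g₁ (-t) = σ * g₁ t := by
    intro t
    simp only [hg₁, neg_neg]
    linear_combination (-(g₀ (-t))) * hσ
  have hsupp₁ : tsupport g₁ ⊆ Icc (-a) a :=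
    tsupport_subset_Icc_of_symm hsupp₀ fun s h1 h2 ↦ by
      simp only [hg₁, h1, h2, mul_zero, add_zero]
  have hval : g₁ (a / 2) = 1 := by
    simp only [hg₁, hg₀, hβ1, hβ0, Complex.ofReal_one, Complex.ofReal_zero, mul_zero, add_zero]
  have hnn : 0 ≤ ∫ t, ‖g₁ t‖ ^ 2 := integral_nonneg fun _ ↦ by positivity
  have hN : 0 < ∫ t, ‖g₁ t‖ ^ 2 := by
    rcases hnn.eq_or_lt with hz | hpos
    · exfalso
      have h0 : g₁ = 0 := hg₁t.eq_zero_of_integral_norm_sq_eq_zero hz.symm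
      have h1 : (1 : ℂ) = 0 := by rw [← hval, h0, Pi.zero_apply]
      exact one_ne_zero h1
    · exact hpos
  set N : ℝ := ∫ t, ‖g₁ t‖ ^ 2 with hN'
  set c : ℝ := (Real.sqrt N)⁻¹ with hc
  have hcpos : 0 < c := inv_pos.2 (Real.sqrt_pos.2 hN)
  refine ⟨fun t ↦ (c : ℂ) * g₁ t, hg₁t.const_mul c, tsupport_mul_subset_right.trans hsupp₁,
    fun t ↦ ?_, ?_⟩
  · show (c : ℂ) * g₁ (-t) = σ * ((c : ℂ) * g₁ t)
    rw [hpar₁ t]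
    ring
  · simp only [norm_mul, mul_pow, Complex.norm_real, Real.norm_of_nonneg hcpos.le]
    rw [integral_const_mul, hc, inv_pow, Real.sq_sqrt hnn, inv_mul_cancel₀ hN.ne']

/-- **The even unit sphere of a window `a > 0` is nonempty**: there is a smooth even `g` with
`tsupport g ⊆ [-a, a]` and `∫ |g|² = 1`. [folklore] -/
theorem exists_isWeilTest_even_sphere {a : ℝ} (ha : 0 < a) :
    ∃ g : ℝ → ℂ, IsWeilTest g ∧ tsupport g ⊆ Icc (-a) a ∧ (∀ t, g (-t) = g t) ∧
      ∫ t, ‖g t‖ ^ 2 = (1 : ℝ) := by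
  obtain ⟨g, hg, hs, hpar, hn⟩ := exists_isWeilTest_sphere_of_sign ha (σ := 1) (by norm_num)
  exact ⟨g, hg, hs, fun t ↦ by rw [hpar t, one_mul], hn⟩

/-- The odd value set of a window `a > 0` is nonempty (`exists_isWeilTest_odd_sphere`). [folklore] -/
theorem weilWindowSphereValues_odd_nonempty {a : ℝ} (ha : 0 < a) :
    (weilWindowSphereValues (fun g ↦ ∀ t, g (-t) = -g t) a).Nonempty := by
  obtain ⟨g, hg, hs, hodd, hn⟩ := exists_isWeilTest_odd_sphere ha
  exact ⟨_, g, hg, hs, hodd, hn, rfl⟩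

/-- The even value set of a window `a > 0` is nonempty. [folklore] -/
theorem weilWindowSphereValues_even_nonempty {a : ℝ} (ha : 0 < a) :
    (weilWindowSphereValues (fun g ↦ ∀ t, g (-t) = g t) a).Nonempty := by
  obtain ⟨g, hg, hs, hev, hn⟩ := exists_isWeilTest_even_sphere ha
  exact ⟨_, g, hg, hs, hev, hn, rfl⟩

/-- The unconstrained value set of a window `a > 0` is nonempty. [folklore] -/
theorem weilWindowSphereValues_top_nonempty {a : ℝ} (ha : 0 < a) :
    (weilWindowSphereValues (fun _ ↦ True) a).Nonempty :=
  (weilWindowSphereValues_odd_nonempty ha).mono (weilWindowSphereValues_subset_top _ a)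

/-! ## API of `weilEvenGroundEnergy`, and the odd lemmas `WeilOddGroundState.lean` lacks -/

section Parity

variable {a b x : ℝ} {g : ℝ → ℂ}

/-- Junk regime: `ε_ev(a) = 0` for `a ≤ 0` (empty sphere, `sInf ∅ = 0`; the odd twin is
`weilOddGroundEnergy_of_nonpos`). [folklore] -/
theorem weilEvenGroundEnergy_of_nonpos (ha : a ≤ 0) : weilEvenGroundEnergy a = 0 :=
  sInf_weilWindowSphereValues_of_nonpos _ ha

/-- Normalised even window tests bound `ε_ev(a)` from above (odd twin: `weilOddGroundEnergy_le`).
[folklore] -/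
theorem weilEvenGroundEnergy_le (hg : IsWeilTest g) (hs : tsupport g ⊆ Icc (-a) a)
    (hev : ∀ t, g (-t) = g t) (hn : ∫ t : ℝ, ‖g t‖ ^ 2 = (1 : ℝ)) :
    weilEvenGroundEnergy a ≤ (weilQuadratic g).re :=
  sInf_weilWindowSphereValues_le_re hg hs hev hn

/-- A lower bound on the odd unit sphere of a window `a > 0` bounds `ε_od(a)` from below.
[folklore] -/
theorem le_weilOddGroundEnergy_of_forall (ha : 0 < a)
    (hb : ∀ g : ℝ → ℂ, IsWeilTest g → tsupport g ⊆ Icc (-a) a → (∀ t, g (-t) = -g t) →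
      ∫ t : ℝ, ‖g t‖ ^ 2 = 1 → x ≤ (weilQuadratic g).re) :
    x ≤ weilOddGroundEnergy a :=
  le_sInf_weilWindowSphereValues (weilWindowSphereValues_odd_nonempty ha) hb

/-- A lower bound on the even unit sphere of a window `a > 0` bounds `ε_ev(a)` from below.
[folklore] -/
theorem le_weilEvenGroundEnergy_of_forall (ha : 0 < a)
    (hb : ∀ g : ℝ → ℂ, IsWeilTest g → tsupport g ⊆ Icc (-a) a → (∀ t, g (-t) = g t) →
      ∫ t : ℝ, ‖g t‖ ^ 2 = 1 → x ≤ (weilQuadratic g).re) :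
    x ≤ weilEvenGroundEnergy a :=
  le_sInf_weilWindowSphereValues (weilWindowSphereValues_even_nonempty ha) hb

/-- **Homogeneous form**: `ε_od(a) · ∫ |g|² ≤ Re Q(g)` for every odd test `g` supported in
`[-a, a]` (oddness is stable under scalars). [cite: Bombieri2000Weil, §4 Problem 2 (p. 193) and Thm. 5] -/
theorem weilOddGroundEnergy_mul_le_re (hg : IsWeilTest g) (hs : tsupport g ⊆ Icc (-a) a)
    (hodd : ∀ t, g (-t) = -g t) :
    weilOddGroundEnergy a * ∫ t, ‖g t‖ ^ 2 ≤ (weilQuadratic g).re :=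
  sInf_weilWindowSphereValues_mul_le_re hg hs fun c _ t ↦ by simp only [hodd t, mul_neg]

/-- **Homogeneous form**: `ε_ev(a) · ∫ |g|² ≤ Re Q(g)` for every even test `g` supported in
`[-a, a]`. [cite: Bombieri2000Weil, §4 Problem 2 (p. 193) and Thm. 5] -/
theorem weilEvenGroundEnergy_mul_le_re (hg : IsWeilTest g) (hs : tsupport g ⊆ Icc (-a) a)
    (hev : ∀ t, g (-t) = g t) :
    weilEvenGroundEnergy a * ∫ t, ‖g t‖ ^ 2 ≤ (weilQuadratic g).re :=
  sInf_weilWindowSphereValues_mul_le_re hg hs fun c _ t ↦ by simp only [hev t]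

/-- `ε_od` is antitone on `(0, ∞)` (`AntitoneOn` form of `weilOddGroundEnergy_antitone`, Bombieri
2000 Thm 5: `μ⁻(M)` is a "decreasing function of `M`"). [cite: Bombieri2000Weil, §4 Thm. 5 (p. 197)] -/
theorem weilOddGroundEnergy_antitoneOn : AntitoneOn weilOddGroundEnergy (Ioi 0) :=
  fun _ hb _ _ hba ↦ weilOddGroundEnergy_antitone hb hba

/-- **`ε_ev` is non-increasing on `(0, ∞)`** (Bombieri 2000 Thm 5 for `μ⁺(M)`: a larger window has
a larger competing class, and the smaller even sphere is nonempty).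
[cite: Bombieri2000Weil, §4 Thm. 5 (p. 197)] -/
theorem weilEvenGroundEnergy_antitone (hb : 0 < b) (hba : b ≤ a) :
    weilEvenGroundEnergy a ≤ weilEvenGroundEnergy b :=
  sInf_weilWindowSphereValues_anti _ (weilWindowSphereValues_even_nonempty hb) hba

/-- `ε_ev` is antitone on `(0, ∞)`. [cite: Bombieri2000Weil, §4 Thm. 5 (p. 197)] -/
theorem weilEvenGroundEnergy_antitoneOn : AntitoneOn weilEvenGroundEnergy (Ioi 0) :=
  fun _ hb _ _ hba ↦ weilEvenGroundEnergy_antitone hb hba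

/-- The parity-free ground energy `ε(a)` is non-increasing on `(0, ∞)` as well (same argument;
recorded here because `Literature/` had no such statement — Summit-side files re-prove it as
`weilGroundEnergy_antitone`). [folklore] -/
theorem weilGroundEnergy_anti (hb : 0 < b) (hba : b ≤ a) :
    weilGroundEnergy a ≤ weilGroundEnergy b := by
  rw [weilGroundEnergy_eq_sInf, weilGroundEnergy_eq_sInf]
  exact sInf_weilWindowSphereValues_anti _ (weilWindowSphereValues_top_nonempty hb) hba

/-- `ε` is antitone on `(0, ∞)`. [folklore] -/
theorem weilGroundEnergy_antitoneOn : AntitoneOn weilGroundEnergy (Ioi 0) :=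
  fun _ hb _ _ hba ↦ weilGroundEnergy_anti hb hba

/-- `ε(a) ≤ ε_ev(a)` for every `a` (the even sphere is a sub-sphere; for `a ≤ 0` both are `0`;
odd twin: `weilGroundEnergy_le_weilOddGroundEnergy`).
[cite: Suzuki2026, §4.5 eq. (4.10), "λ_a ≤ min(λ_a⁺, λ_a⁻)"] -/
theorem weilGroundEnergy_le_weilEvenGroundEnergy (a : ℝ) :
    weilGroundEnergy a ≤ weilEvenGroundEnergy a := by
  rcases le_or_gt a 0 with ha | ha
  · rw [weilEvenGroundEnergy_of_nonpos ha, weilGroundEnergy_of_nonpos ha]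
  · rw [weilGroundEnergy_eq_sInf, weilEvenGroundEnergy_eq_sInf]
    exact csInf_le_csInf (bddBelow_weilWindowSphereValues _ a)
      (weilWindowSphereValues_even_nonempty ha) (weilWindowSphereValues_subset_top _ a)

end Parity

/-! ## The parity split `ε(a) = min (ε_ev(a), ε_od(a))` (Suzuki 2026, §4.5, (4.10)) -/

/-- The parallelogram identity behind `‖g‖² = ‖g_ev‖² + ‖g_od‖²`, pointwise:
`|(x + y)/2|² + |(x − y)/2|² = (|x|² + |y|²)/2`. [folklore] -/
theorem norm_sq_half_add_add_norm_sq_half_sub (x y : ℂ) :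
    ‖(x + y) / 2‖ ^ 2 + ‖(x - y) / 2‖ ^ 2 = (‖x‖ ^ 2 + ‖y‖ ^ 2) / 2 := by
  have h := parallelogram_law_with_norm ℂ x y
  rw [norm_div, norm_div, Complex.norm_two, div_pow, div_pow]
  norm_num
  linarith

/-- **`‖g‖₂² = ‖g_ev‖₂² + ‖g_od‖₂²`** for the even part `g_ev = ½(g + g(-·))` and the odd part
`g_od = ½(g − g(-·))` of a test function (parallelogram identity pointwise and `∫ |g(-t)|² = ∫ |g|²`;
Suzuki 2026 §4.5: "`‖v‖² = ‖v⁺‖² + ‖v⁻‖²` for the denominator").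
[cite: Suzuki2026, §4.5 (proof of (4.10))] -/
theorem integral_norm_sq_evenPart_add_oddPart {g : ℝ → ℂ} (hg : IsWeilTest g) :
    (∫ t, ‖(g t + g (-t)) / 2‖ ^ 2) + ∫ t, ‖(g t - g (-t)) / 2‖ ^ 2 = ∫ t, ‖g t‖ ^ 2 := by
  rw [← integral_add hg.evenPart.integrable_norm_sq hg.oddPart.integrable_norm_sq]
  simp_rw [norm_sq_half_add_add_norm_sq_half_sub]
  rw [integral_div, integral_add hg.integrable_norm_sq hg.comp_neg.integrable_norm_sq,
    integral_neg_eq_self (fun t : ℝ ↦ ‖g t‖ ^ 2) volume]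
  ring

/-- **The parity split of the ground energy**: `ε(a) = min (ε_ev(a), ε_od(a))` for every `a`
(Suzuki 2026, §4.5, eq. (4.10) `λ_a = min(λ_a⁺, λ_a⁻)`, with his proof: `≤` because the even and
odd spheres are sub-spheres; `≥` because for a normalised window test `g = g_ev + g_od` one has
`Q(g) = Q(g_ev) + Q(g_od)` — the cross terms vanish, `weilQuadratic_eq_evenPart_add_oddPart`,
Connes–Consani's `QW_λ = QW_λ⁺ ⊕ QW_λ⁻` — and `‖g_ev‖² + ‖g_od‖² = 1`, so
`Re Q(g) ≥ ε_ev‖g_ev‖² + ε_od‖g_od‖² ≥ min(ε_ev, ε_od)`). For `a ≤ 0` all three are the junk value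
`0`. [cite: Suzuki2026, §4.5 eq. (4.10) (arXiv p. 18)] -/
theorem weilGroundEnergy_eq_min_even_odd (a : ℝ) :
    weilGroundEnergy a = min (weilEvenGroundEnergy a) (weilOddGroundEnergy a) := by
  refine le_antisymm (le_min (weilGroundEnergy_le_weilEvenGroundEnergy a)
    (weilGroundEnergy_le_weilOddGroundEnergy a)) ?_
  rcases le_or_gt a 0 with ha | ha
  · rw [weilEvenGroundEnergy_of_nonpos ha, weilOddGroundEnergy_of_nonpos ha,
      weilGroundEnergy_of_nonpos ha, min_self]
  · rw [weilGroundEnergy_eq_sInf]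
    refine le_sInf_weilWindowSphereValues (weilWindowSphereValues_top_nonempty ha)
      fun g hg hs _ hn ↦ ?_
    set E : ℝ := weilEvenGroundEnergy a with hE
    set O : ℝ := weilOddGroundEnergy a with hO
    -- even and odd parts: test functions on the same window, of the right parity
    have het : IsWeilTest fun t ↦ (g t + g (-t)) / 2 := hg.evenPart
    have hot : IsWeilTest fun t ↦ (g t - g (-t)) / 2 := hg.oddPart
    have hes : tsupport (fun t ↦ (g t + g (-t)) / 2) ⊆ Icc (-a) a :=
      tsupport_subset_Icc_of_symm hs fun s h1 h2 ↦ by simp only [h1, h2, add_zero, zero_div]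
    have hos : tsupport (fun t ↦ (g t - g (-t)) / 2) ⊆ Icc (-a) a :=
      tsupport_subset_Icc_of_symm hs fun s h1 h2 ↦ by simp only [h1, h2, sub_zero, zero_div]
    have heven : ∀ t, (fun t ↦ (g t + g (-t)) / 2) (-t) = (fun t ↦ (g t + g (-t)) / 2) t := by
      intro t
      simp only [neg_neg]
      ring
    have hodd : ∀ t, (fun t ↦ (g t - g (-t)) / 2) (-t) = -(fun t ↦ (g t - g (-t)) / 2) t := by
      intro t
      simp only [neg_neg]
      ring
    -- the two homogeneous bounds and the norm identity
    have hEb := weilEvenGroundEnergy_mul_le_re het hes heven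
    have hOb := weilOddGroundEnergy_mul_le_re hot hos hodd
    set Ne : ℝ := ∫ t, ‖(g t + g (-t)) / 2‖ ^ 2 with hNe
    set No : ℝ := ∫ t, ‖(g t - g (-t)) / 2‖ ^ 2 with hNo
    have hNe0 : 0 ≤ Ne := integral_nonneg fun _ ↦ by positivity
    have hNo0 : 0 ≤ No := integral_nonneg fun _ ↦ by positivity
    have hsum : Ne + No = 1 := by rw [hNe, hNo, integral_norm_sq_evenPart_add_oddPart hg, hn]
    have hQ : (weilQuadratic g).re =
        (weilQuadratic fun t ↦ (g t + g (-t)) / 2).re +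
          (weilQuadratic fun t ↦ (g t - g (-t)) / 2).re := by
      rw [weilQuadratic_eq_evenPart_add_oddPart hg, Complex.add_re]
    have h1 : min E O * Ne ≤ E * Ne := mul_le_mul_of_nonneg_right (min_le_left _ _) hNe0
    have h2 : min E O * No ≤ O * No := mul_le_mul_of_nonneg_right (min_le_right _ _) hNo0
    calc min E O = min E O * Ne + min E O * No := by rw [← mul_add, hsum, mul_one]
      _ ≤ E * Ne + O * No := add_le_add h1 h2
      _ ≤ (weilQuadratic fun t ↦ (g t + g (-t)) / 2).re +
            (weilQuadratic fun t ↦ (g t - g (-t)) / 2).re := add_le_add hEb hOb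
      _ = (weilQuadratic g).re := hQ.symm

/-! ## Sign of `ε_od` and the Riemann hypothesis -/

/-- **`ε_od(a) ≥ 0` iff odd-sector Weil positivity holds on the window**: for every `a`,
`0 ≤ ε_od(a) ↔ ∀ g` odd test with `tsupport g ⊆ [-a, a]`, `0 ≤ Re Q(g)` (twin of
`weilGroundEnergy_nonneg_iff_holds`; `→` by the homogeneous bound, `←` by `Real.sInf_nonneg`; no
sign condition on `a` is needed, both sides holding trivially for `a ≤ 0`).
[cite: Bombieri2000Weil, §4 Problem 2 and Thm. 5] -/
theorem weilOddGroundEnergy_nonneg_iff (a : ℝ) :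
    0 ≤ weilOddGroundEnergy a ↔
      ∀ g : ℝ → ℂ, IsWeilTest g → tsupport g ⊆ Icc (-a) a → (∀ t, g (-t) = -g t) →
        0 ≤ (weilQuadratic g).re :=
  sInf_weilWindowSphereValues_nonneg_iff fun c g _ hg t ↦ by simp only [hg t, mul_neg]

/-- The even twin: `0 ≤ ε_ev(a)` iff `Re Q ≥ 0` on even tests of the window.
[cite: Bombieri2000Weil, §4 Problem 2 and Thm. 5] -/
theorem weilEvenGroundEnergy_nonneg_iff (a : ℝ) :
    0 ≤ weilEvenGroundEnergy a ↔
      ∀ g : ℝ → ℂ, IsWeilTest g → tsupport g ⊆ Icc (-a) a → (∀ t, g (-t) = g t) →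
        0 ≤ (weilQuadratic g).re :=
  sInf_weilWindowSphereValues_nonneg_iff fun c g _ hg t ↦ by simp only [hg t]

/-- **RH ⇒ `ε_od(a) ≥ 0` for every window** (unconditional: the proved "if" half of Yoshida's
Prop. 1(1), `yoshida_odd_criterion_mp`, i.e. Weil positivity under RH via the discharged explicit
formula). [cite: Yoshida1992HermitianForms, Prop. 1(1), "if" part (p. 286)] -/
theorem weilOddGroundEnergy_nonneg_of_riemannHypothesis (hRH : RiemannHypothesis) (a : ℝ) :
    0 ≤ weilOddGroundEnergy a :=
  (weilOddGroundEnergy_nonneg_iff a).2 fun g hg _ hodd ↦ yoshida_odd_criterion_mp hRH g hg hodd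

/-- Every test function lives on some window `a > 0`. [folklore] -/
theorem IsWeilTest.exists_tsupport_subset_Icc {g : ℝ → ℂ} (hg : IsWeilTest g) :
    ∃ a : ℝ, 0 < a ∧ tsupport g ⊆ Icc (-a) a := by
  obtain ⟨R, hR⟩ := hg.2.isCompact.isBounded.subset_closedBall 0
  refine ⟨max R 1, lt_max_of_lt_right one_pos, hR.trans ?_⟩
  rw [Real.closedBall_eq_Icc, zero_sub, zero_add]
  exact Icc_subset_Icc (neg_le_neg (le_max_left _ _)) (le_max_left _ _)

/-- **Yoshida's odd criterion in ground-energy form** (given the named fact `yoshida_odd_criterion`,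
Yoshida 1992 Prop. 1(1) for `k = ℚ`: "`T_k` is oddly positive definite if and only if R.H.
holds"): `RH ↔ ε_od(a) ≥ 0` for every window `a > 0` (every odd test lives on some window,
`weilOddGroundEnergy_nonneg_iff`). [cite: Yoshida1992HermitianForms, Prop. 1(1) (p. 285)] -/
theorem yoshida_odd_criterion.riemannHypothesis_iff_weilOddGroundEnergy_nonneg
    (h : yoshida_odd_criterion) :
    RiemannHypothesis ↔ ∀ a : ℝ, 0 < a → 0 ≤ weilOddGroundEnergy a := by
  refine ⟨fun hRH a _ ↦ weilOddGroundEnergy_nonneg_of_riemannHypothesis hRH a, fun hpos ↦ ?_⟩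
  refine h.2 fun g hg hodd ↦ ?_
  obtain ⟨a, ha, hs⟩ := hg.exists_tsupport_subset_Icc
  exact (weilOddGroundEnergy_nonneg_iff a).1 (hpos a ha) g hg hs hodd

end Literature.NumberTheory.LFunctions
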